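import Summits.ValiantsHypothesis.ValiantsHypothesis.Theses.ImmanantSlice
import Summits.ValiantsHypothesis.ValiantsHypothesis.Theorems.ImmanantSliceDeterminantalRigidityReductions
import Literature.Computability.AlgebraicComplexity.PermanentVsDeterminant

/-!
# `ImmanantSlice.TwoClassRigidity` (stmt-ValiantsHypothesis-4209) — the determinantal split

The deciding crux `TwoClassRigidity` (TCR) of route `ImmanantSlice` is at least as strong as the
summit (`closes : TwoClassRigidity → ValiantsHypothesis`, instantiate `χ ≡ 1`). This file proves
the ASSEMBLY of its typed decomposition through the intermediate measure "affine determinantal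
complexity" (`dc`), the one complexity measure below `VP` whose lower bound for the permanent is
open and does NOT imply `VP ≠ VNP`:

* piece 1, `SliceVBP` — *VP = VBP on Schur's class-function slice*: every `VP` p-family of
  generalized matrix functions `d_{χ_n} = ∑_σ χ_n(σ) ∏ᵢ x_{σ(i),i}` of CLASS FUNCTIONS `χ_n` has
  p-bounded `dc`;
* piece 2, `DcTwoClassRigidity` — the `dc` shadow of two-class rigidity (the route's support item
  `DeterminantalRigidity` restricted to permutations with at most two cycles): class-function
  families with p-bounded `dc(d_{χ_n})` are, for some `k` and all large `n`, of the form `c · sgn`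
  on the `≤ 2`-cycle classes of `Π_k(n)` (no fixed point, all cycles longer than `k`).

Main theorem `twoClassRigidity_of_sliceVBP_of_dcTwoClassRigidity : piece 1 → piece 2 → TCR`
(the hypotheses are spelled out verbatim, so that the route's split children unfold to them).
The remaining theorems PLACE the pieces: piece 2 follows from `DeterminantalRigidity` and from
`TwoClassRigidity` itself (so it is a genuine weakening of the crux) and implies Valiant's
permanent-versus-determinant conjecture `DcPerSuperpolynomial ℂ` (registered OPEN, `VNP ⊄ VBP`;
it does not give `VP ≠ VNP`); piece 1 upgrades `DeterminantalRigidity` to the route TARGET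
`CuspidalRigidity` and is precisely the transfer `DcPerSuperpolynomial ℂ → ValiantsHypothesis` on
the slice. Elementary; no new definitions, no named facts.
-/

noncomputable section

namespace Summit.ValiantsHypothesis.Theorems.TwoClassRigiditySplit

open MvPolynomial Literature.Computability.AlgebraicComplexity
open Summit.ValiantsHypothesis.ValiantsHypothesis.Theses.ImmanantSlice
open Summit.ValiantsHypothesis.Theorems.DeterminantalRigidityReductions

set_option quotPrecheck false in
/-- Piece 1 of the split, *VP = VBP on the class-function slice* (the future route decl
`ImmanantSlice.SliceVBP` unfolds to this term). -/
local notation "SliceVBPProp" =>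
  ∀ χ : (n : ℕ) → Equiv.Perm (Fin n) → ℂ, (∀ n (σ τ : Equiv.Perm (Fin n)), IsConj σ τ → χ n σ = χ n τ) → Literature.Computability.AlgebraicComplexity.IsVPFamily (fun n => ∑ σ : Equiv.Perm (Fin n), MvPolynomial.C (χ n σ) * ∏ i : Fin n, MvPolynomial.X (σ i, i)) → Literature.Computability.AlgebraicComplexity.IsPBounded (fun n => Literature.Computability.AlgebraicComplexity.determinantalComplexity (∑ σ : Equiv.Perm (Fin n), MvPolynomial.C (χ n σ) * ∏ i : Fin n, MvPolynomial.X (σ i, i)))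

set_option quotPrecheck false in
/-- Piece 2 of the split, *dc two-class rigidity* (the future route decl
`ImmanantSlice.DcTwoClassRigidity` unfolds to this term). -/
local notation "DcTwoClassRigidityProp" =>
  ∀ χ : (n : ℕ) → Equiv.Perm (Fin n) → ℂ, (∀ n (σ τ : Equiv.Perm (Fin n)), IsConj σ τ → χ n σ = χ n τ) → Literature.Computability.AlgebraicComplexity.IsPBounded (fun n => Literature.Computability.AlgebraicComplexity.determinantalComplexity (∑ σ : Equiv.Perm (Fin n), MvPolynomial.C (χ n σ) * ∏ i : Fin n, MvPolynomial.X (σ i, i))) → ∃ k n₀ : ℕ, ∀ n, n₀ ≤ n → ∃ c : ℂ, ∀ σ : Equiv.Perm (Fin n), (∀ i, σ i ≠ i) → (∀ m ∈ σ.cycleType, k < m) → Multiset.card σ.cycleType ≤ 2 → χ n σ = c * ((Equiv.Perm.sign σ : ℤ) : ℂ)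

/-! ### The assembly -/

/-- **Assembly of the split** `SliceVBP → DcTwoClassRigidity → TwoClassRigidity`: a `VP`
class-function family has p-bounded `dc` (piece 1), hence is eventually `c · sgn` on the
`≤ 2`-cycle part of `Π_k(n)` (piece 2); an `n`-cycle `σ` and a permutation `τ` of type `(a, n-a)`
with `k < a`, `k < n - a` both lie there (fixed-point-free as their cycle types sum to `n`) and have
opposite signs (`sgn = (-1)^{∑ cycleType + #cycleType}`), so `χ σ = c·sgn σ = -c·sgn τ = -χ τ`.
[folklore] -/
theorem twoClassRigidity_of_sliceVBP_of_dcTwoClassRigidity (h₁ : SliceVBPProp)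
    (h₂ : DcTwoClassRigidityProp) : TwoClassRigidity := by
  intro χ hχ hVP
  obtain ⟨k, n₀, hk⟩ := h₂ χ hχ (h₁ χ hχ hVP)
  refine ⟨k, n₀, fun n hn a ha hna σ τ hσ hτ => ?_⟩
  obtain ⟨c, hc⟩ := hk n hn
  obtain ⟨b, rfl⟩ : ∃ b, n = a + b := ⟨n - a, by omega⟩
  rw [Nat.add_sub_cancel_left] at hτ hna
  have hσfpf : ∀ i, σ i ≠ i := ne_self_of_sum_cycleType (by rw [hσ]; simp)
  have hτfpf : ∀ i, τ i ≠ i :=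
    ne_self_of_sum_cycleType (by rw [hτ]; simp [Multiset.insert_eq_cons])
  have hσlong : ∀ m ∈ σ.cycleType, k < m := fun m hm => by
    rw [hσ, Multiset.mem_singleton] at hm; omega
  have hτlong : ∀ m ∈ τ.cycleType, k < m := fun m hm => by
    rw [hτ] at hm
    simp only [Multiset.insert_eq_cons, Multiset.mem_cons, Multiset.mem_singleton] at hm
    rcases hm with rfl | rfl <;> omega
  have hσcard : Multiset.card σ.cycleType ≤ 2 := by rw [hσ]; simp
  have hτcard : Multiset.card τ.cycleType ≤ 2 := by rw [hτ]; simp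
  have hsign := sign_eq_neg_sign_of_cycleType hσ hτ
  rw [hc σ hσfpf hσlong hσcard, hc τ hτfpf hτlong hτcard, hsign, Units.val_neg, Int.cast_neg,
    mul_neg, neg_neg]

/-- The split assembles to the summit through the route's deciding theorem `closes`.
[folklore] -/
theorem valiantsHypothesis_of_sliceVBP_of_dcTwoClassRigidity (h₁ : SliceVBPProp)
    (h₂ : DcTwoClassRigidityProp) : ValiantsHypothesis :=
  closes (twoClassRigidity_of_sliceVBP_of_dcTwoClassRigidity h₁ h₂)

/-! ### Placing piece 2 -/

/-- `DeterminantalRigidity → DcTwoClassRigidity`: drop the `≤ 2`-cycle restriction (the piece is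
the route's support item `DeterminantalRigidity` on a smaller locus). [folklore] -/
theorem dcTwoClassRigidity_of_determinantalRigidity (hDR : DeterminantalRigidity) :
    DcTwoClassRigidityProp := fun χ hχ hdc => by
  obtain ⟨k, n₀, hk⟩ := hDR χ hχ hdc
  exact ⟨k, n₀, fun n hn => (hk n hn).imp fun c hc σ h1 h2 _ => hc σ h1 h2⟩

/-- `TwoClassRigidity → DcTwoClassRigidity`: piece 2 is a CONSEQUENCE of the crux. P-bounded `dc`
gives a `VP` family (`isVPFamily_of_isPBounded_determinantalComplexity`); for `n ≥ max n₀ 2` take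
`c = χ(σ₀) · sgn σ₀` for an `n`-cycle `σ₀`: a fixed-point-free `σ` with `≤ 2` cycles is either an
`n`-cycle (conjugate to `σ₀`, same sign) or of type `(a, b)` with `a + b = n`, where the two-class
relation `χ σ₀ = -χ σ` and `sgn σ = -sgn σ₀` give `χ σ = c · sgn σ`. [folklore] -/
theorem dcTwoClassRigidity_of_twoClassRigidity (h : TwoClassRigidity) : DcTwoClassRigidityProp := by
  intro χ hχ hdc
  have hVP := isVPFamily_of_isPBounded_determinantalComplexity
    (ι := fun n => Fin n × Fin n)
    ((IsPBounded.mul_holds IsPBounded.id IsPBounded.id).mono fun n => by simp) hdc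
  obtain ⟨k, n₀, hk⟩ := h χ hχ hVP
  refine ⟨k, max n₀ 2, fun n hn => ?_⟩
  have hn₀ : n₀ ≤ n := le_trans (le_max_left _ _) hn
  have hn2 : 2 ≤ n := le_trans (le_max_right _ _) hn
  obtain ⟨σ₀, hσ₀⟩ : ∃ σ₀ : Equiv.Perm (Fin n), σ₀.cycleType = {n} :=
    (Equiv.Perm.exists_with_cycleType_iff (Fin n)).2
      ⟨by simp, by simp only [Multiset.mem_singleton, forall_eq]; omega⟩
  refine ⟨χ n σ₀ * ((Equiv.Perm.sign σ₀ : ℤ) : ℂ), fun σ hfpf hlong hcard => ?_⟩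
  have hsum : σ.cycleType.sum = n := (forall_ne_self_iff_sum_cycleType σ).1 hfpf
  have hsq : ((Equiv.Perm.sign σ₀ : ℤ) : ℂ) * ((Equiv.Perm.sign σ₀ : ℤ) : ℂ) = 1 := by
    rw [← Int.cast_mul, ← Units.val_mul, Int.units_mul_self, Units.val_one, Int.cast_one]
  have hcases : Multiset.card σ.cycleType = 0 ∨ Multiset.card σ.cycleType = 1 ∨
      Multiset.card σ.cycleType = 2 := by omega
  rcases hcases with h0 | h1 | h2
  · -- no cycle: `σ = 1`, impossible for a fixed-point-free permutation of `n ≥ 2` letters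
    exfalso
    rw [Multiset.card_eq_zero] at h0
    rw [h0, Multiset.sum_zero] at hsum
    omega
  · -- one cycle: `σ` is an `n`-cycle, conjugate to `σ₀`
    obtain ⟨m, hm⟩ := Multiset.card_eq_one.1 h1
    rw [hm, Multiset.sum_singleton] at hsum
    subst hsum
    have hconj : IsConj σ σ₀ := Equiv.Perm.isConj_iff_cycleType_eq.2 (by rw [hm, hσ₀])
    have hsgn : Equiv.Perm.sign σ = Equiv.Perm.sign σ₀ := by
      rw [Equiv.Perm.sign_of_cycleType, Equiv.Perm.sign_of_cycleType, hm, hσ₀]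
    rw [hχ _ σ σ₀ hconj, hsgn, mul_assoc, hsq, mul_one]
  · -- two cycles `(a, b)`, `a + b = n`, both longer than `k`: the two-class relation applies
    obtain ⟨a, b, hab⟩ := Multiset.card_eq_two.1 h2
    rw [hab] at hsum hlong
    simp only [Multiset.insert_eq_cons, Multiset.sum_cons, Multiset.sum_singleton] at hsum
    subst hsum
    have ha : k < a := hlong a (by simp)
    have hb : k < b := hlong b (by simp)
    have hrel := hk (a + b) hn₀ a ha (by rw [Nat.add_sub_cancel_left]; exact hb) σ₀ σ hσ₀
      (by rw [Nat.add_sub_cancel_left]; exact hab)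
    have hsign := sign_eq_neg_sign_of_cycleType hσ₀ hab
    rw [hsign, Units.val_neg, Int.cast_neg, mul_neg, mul_assoc, hsq, mul_one, hrel, neg_neg]

/-- `DcTwoClassRigidity → DcPerSuperpolynomial ℂ`: piece 2 is at least Valiant's
permanent-versus-determinant conjecture (Valiant 1979; Landsberg 2017, Conj. 1.2.4.2 — registered
OPEN as `DcPerSuperpolynomialComplex`; it is `VNP ⊄ VBP`, not `VP ≠ VNP`): apply the piece to
`χ ≡ 1`, `d_χ = per_n`; an `n`-cycle and a product of two long cycles have opposite signs, so
`1 = c · sgn` fails for one of them. [folklore] -/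
theorem dcPerSuperpolynomial_of_dcTwoClassRigidity (h₂ : DcTwoClassRigidityProp) :
    DcPerSuperpolynomial ℂ := by
  intro hB
  have hfun : (fun n => determinantalComplexity
      (∑ σ : Equiv.Perm (Fin n), C ((fun (_ : ℕ) (_ : Equiv.Perm (Fin _)) => (1 : ℂ)) n σ) *
        ∏ i : Fin n, X (σ i, i))) =
      fun n => determinantalComplexity (perPoly (Fin n) ℂ) :=
    funext fun n => congrArg determinantalComplexity (sum_C_one_mul_prod_eq_perPoly n)
  have hB' : IsPBounded (fun n => determinantalComplexity
      (∑ σ : Equiv.Perm (Fin n), C ((fun (_ : ℕ) (_ : Equiv.Perm (Fin _)) => (1 : ℂ)) n σ) *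
        ∏ i : Fin n, X (σ i, i))) := by
    rw [hfun]; exact hB
  obtain ⟨k, n₀, hk⟩ := h₂ (fun _ _ => 1) (fun _ _ _ _ => rfl) hB'
  obtain ⟨σ, τ, hσ, hτ⟩ :=
    exists_cycle_and_pair (a := k + 2) (b := n₀ + k + 2) (by omega) (by omega)
  obtain ⟨c, hc⟩ := hk (k + 2 + (n₀ + k + 2)) (by omega)
  have hσfpf : ∀ i, σ i ≠ i := ne_self_of_sum_cycleType (by rw [hσ]; simp)
  have hτfpf : ∀ i, τ i ≠ i :=
    ne_self_of_sum_cycleType (by rw [hτ]; simp [Multiset.insert_eq_cons])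
  have hσlong : ∀ m ∈ σ.cycleType, k < m := fun m hm => by
    rw [hσ, Multiset.mem_singleton] at hm; omega
  have hτlong : ∀ m ∈ τ.cycleType, k < m := fun m hm => by
    rw [hτ] at hm
    simp only [Multiset.insert_eq_cons, Multiset.mem_cons, Multiset.mem_singleton] at hm
    rcases hm with rfl | rfl <;> omega
  have hσcard : Multiset.card σ.cycleType ≤ 2 := by rw [hσ]; simp
  have hτcard : Multiset.card τ.cycleType ≤ 2 := by rw [hτ]; simp
  have h1 : (1 : ℂ) = c * ((Equiv.Perm.sign σ : ℤ) : ℂ) := hc σ hσfpf hσlong hσcard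
  have h2 : (1 : ℂ) = c * ((Equiv.Perm.sign τ : ℤ) : ℂ) := hc τ hτfpf hτlong hτcard
  rw [sign_eq_neg_sign_of_cycleType hσ hτ, Units.val_neg, Int.cast_neg, mul_neg, ← h1] at h2
  norm_num at h2

/-- The same conclusion spelled as the tree's registered open statement
`DcPerSuperpolynomialComplex` (Landsberg 2017, Conj. 1.2.4.2). [folklore] -/
theorem dcPerSuperpolynomialComplex_of_dcTwoClassRigidity (h₂ : DcTwoClassRigidityProp) :
    DcPerSuperpolynomialComplex :=
  dcPerSuperpolynomial_of_dcTwoClassRigidity h₂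

/-! ### Placing piece 1 -/

/-- `SliceVBP` upgrades the route's support item `DeterminantalRigidity` (the `dc`/`VBP` special
case of the target) to the route TARGET `CuspidalRigidity`. [folklore] -/
theorem cuspidalRigidity_of_sliceVBP_of_determinantalRigidity (h₁ : SliceVBPProp)
    (hDR : DeterminantalRigidity) : CuspidalRigidity :=
  fun χ hχ hVP => hDR χ hχ (h₁ χ hχ hVP)

/-- `SliceVBP` is exactly the transfer "permanent versus determinant ⟹ Valiant's hypothesis" on
the slice: under `SliceVBP`, if `VP ℂ = VNP ℂ` then `(per_n)` — Valiant's `per ∈ VNP`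
(`perFamily_mem_VNP_holds`) and the bundling bridge (`mem_VP_ofFintype_iff_holds`) — is a `VP` family
of generalized matrix functions of the class function `χ ≡ 1`, hence `dc(per_n)` is p-bounded,
contradicting `DcPerSuperpolynomial ℂ`. [folklore] -/
theorem valiantsHypothesis_of_sliceVBP_of_dcPerSuperpolynomial (h₁ : SliceVBPProp)
    (h₃ : DcPerSuperpolynomial ℂ) : ValiantsHypothesis := by
  classical
  show Literature.Computability.AlgebraicComplexity.VP ℂ ≠
    Literature.Computability.AlgebraicComplexity.VNP ℂ
  intro hEq
  have hVNP := perFamily_mem_VNP_holds ℂ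
  have hVP : perFamily ℂ ∈ Literature.Computability.AlgebraicComplexity.VP ℂ := by
    rw [hEq]; exact hVNP
  have hfam : IsVPFamily (fun n => perPoly (Fin n) ℂ) := (mem_VP_ofFintype_iff_holds _).1 hVP
  have hper : (fun n => ∑ σ : Equiv.Perm (Fin n),
      C ((fun (m : ℕ) (_ : Equiv.Perm (Fin m)) => (1 : ℂ)) n σ) * ∏ i : Fin n, X (σ i, i)) =
      fun n => perPoly (Fin n) ℂ :=
    funext fun n => sum_C_one_mul_prod_eq_perPoly n
  have hfam' : IsVPFamily (fun n => ∑ σ : Equiv.Perm (Fin n),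
      C ((fun (m : ℕ) (_ : Equiv.Perm (Fin m)) => (1 : ℂ)) n σ) * ∏ i : Fin n, X (σ i, i)) := by
    rw [hper]; exact hfam
  have hdc := h₁ (fun (m : ℕ) (_ : Equiv.Perm (Fin m)) => (1 : ℂ)) (fun _ _ _ _ => rfl) hfam'
  have hfun : (fun n => determinantalComplexity
      (∑ σ : Equiv.Perm (Fin n), C ((fun (m : ℕ) (_ : Equiv.Perm (Fin m)) => (1 : ℂ)) n σ) *
        ∏ i : Fin n, X (σ i, i))) =
      fun n => determinantalComplexity (perPoly (Fin n) ℂ) :=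
    funext fun n => congrArg determinantalComplexity (sum_C_one_mul_prod_eq_perPoly n)
  rw [hfun] at hdc
  exact h₃ hdc

end Summit.ValiantsHypothesis.Theorems.TwoClassRigiditySplit
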